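import Mathlib
import HarnessLib
import Literature.Analysis.FluidPDE.Tao2016AveragedNS.BoundedEternalSolutions
import Summits.NavierStokesRegularity.NavierStokesRegularity.Theorems.TaoLadderRungTwoBreakEternalRigidityViscBddOneViscousTypeILawLimit
import Summits.NavierStokesRegularity.NavierStokesRegularity.Theorems.TaoLadderRungTwoBreakEternalRigidityViscBddOneDefs
import Summits.NavierStokesRegularity.NavierStokesRegularity.Theorems.TaoLadderRungTwoBreakEternalRigidityViscBddOneCriticalRate
import Summits.NavierStokesRegularity.NavierStokesRegularity.Theorems.TaoLadderRungTwoBreakEternalRigidityViscBddOneFrontClock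
import Summits.NavierStokesRegularity.NavierStokesRegularity.Theorems.WakeRatchetMinimalViscousBlowupThresholdContinuity

/-!
# Crux `TaoLadderRungTwoBreak.EternalRigidityViscBddOne` (stmt-NavierStokesRegularity-20420): KNSS ONE MODEL DOWN, LAW-ONLY, VISCOUS — a type-I
# viscous blow-up has a NON-TRIVIAL UNIFORMLY BOUNDED ω-limit solving the law of `IsEternalVisc ε₀ ν̂ α` on all of `ℝ` (part 2/2)

MODEL lattice ODEs only (Tao 2016 §4: the exact NS-scaled `ν`-viscous cascade lattice of a table of `InTableClass R`, `m = 4`, from a one-shell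
datum, in the registered vocabulary `ViscousUpTo` / `BlowsUpAt` / `TypeOne` of the skeleton `85fbfe8e90eea58b`; self-similar variables of §6.4);
nothing here is a statement about the Navier–Stokes equations; no stub, crux or summit is closed (`--supports stmt-NavierStokesRegularity-20420`).

* `nontrivialViscousEternalLaw_of_typeOne` — `ViscousUpTo ε₀ ν α X₀ X t⋆ ∧ BlowsUpAt ε₀ X t⋆ ∧ TypeOne ε₀ X t⋆` (`α ∈ InTableClass R`, `ν > 0`) ⟹
  `∃ ν̂ ≥ 0, ∃ W : ℤ → ℝ → ℝ⁴` satisfying the law of `IsEternalVisc ε₀ ν̂ α` at every `(n,σ)`, `UniformBound W`, `‖W_0(0)‖ ≥ 1/(32(3+Λ))`.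
  Centres = the critical-front modes `(F_j, t_j)`, `t_j ↑ t⋆` (`CriticalRate.typeOne_quantity_lower_bound`); their frame viscosities are
  `< K₁` (`FrontClock.frontClock_of_typeOne`); compactness and law closure = `ViscousLawLimit.viscousEternalLawLimit_of_typeI` (part 1/2).
READING for ⟨20420⟩ (ω4) `stub_eternalLimitViscBdd` («`… ⟹ ∃ ν̂ W, IsEternalVisc ε₀ ν̂ α W ∧ UniformBound W ∧ EternalSurvivingFwd 1 ε₀ W`»): this `W`
has the LAW of `IsEternalVisc` everywhere, `nonneg`, and `UniformBound`; what remains is exactly the admissibility clauses `action` (uniform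
per-shell log-time action) and `bdd` (per-shell forward envelope) and the (S₁)-survival — the clock-type part (uniform critical action / log-time
hop clock along the blow-up).  HONEST LABEL: (ω3) (type I itself), (ω4), ⟨20420⟩ and every NS statement remain OPEN; rung 0.
-/

noncomputable section

-- the summit and its single sub-problem share the name (CONVENTIONS §1)
set_option linter.dupNamespace false

open Set Filter Topology
open Literature.Analysis.FluidPDE Literature.Analysis.FluidPDE.TaoCascade
open Summit.NavierStokesRegularity.NavierStokesRegularity.Theorems.BlowupRigidityOne
open Summit.NavierStokesRegularity.NavierStokesRegularity.Theorems.MinimalViscousBlowup.ThresholdRay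
open Summit.NavierStokesRegularity.NavierStokesRegularity.Theorems.EternalRigidityViscBddOne.Birth
open Summit.NavierStokesRegularity.NavierStokesRegularity.Theorems.EternalRigidityViscBddOne.CriticalRate
open Summit.NavierStokesRegularity.NavierStokesRegularity.Theorems.EternalRigidityViscBddOne.FrontClock

namespace Summit.NavierStokesRegularity.NavierStokesRegularity.Theorems.EternalRigidityViscBddOne.ViscousLawLimit

/-! ### In the skeleton's vocabulary: the non-trivial bounded viscous eternal law-solution of a type-I viscous blow-up -/

/-- **KNSS ONE MODEL DOWN, LAW-ONLY, VISCOUS: a type-I viscous blow-up has a NON-TRIVIAL UNIFORMLY BOUNDED ω-limit solving the law of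
`IsEternalVisc ε₀ ν̂ α` on all of `ℝ` for some `ν̂ ≥ 0`.**  For a table of `InTableClass R`, `ε₀ > 0`, `ν > 0`: if
`ViscousUpTo ε₀ ν α X₀ X t⋆`, `BlowsUpAt ε₀ X t⋆` and `TypeOne ε₀ X t⋆`, then there are `ν̂ ≥ 0` and `W : ℤ → ℝ → ℝ⁴` such that `W` satisfies
the law of `IsEternalVisc ε₀ ν̂ α` at EVERY `(n, σ)`, `UniformBound W`, and `‖W_0(0)‖ ≥ 1/(32(3+Λ)) > 0`.  (Centres: the critical-front modes
`(F_j, t_j)`, `t_j ↑ t⋆`, of `CriticalRate.typeOne_quantity_lower_bound`; their frame viscosities `ν(1+ε₀)^{2F_j}(t⋆−t_j)` are `< K₁` by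
`FrontClock.frontClock_of_typeOne`; `viscousEternalLawLimit_of_typeI`.)  What this is NOT: `W` is not shown admissible (`action`, `bdd`) nor
(S₁)-surviving — the remaining, clock-type content of (ω4) `stub_eternalLimitViscBdd`.  MODEL lattice only.
[cite: Tao2016AveragedNS, §4 Thm. 4.2 (statement shape), the viscous equation before it, §6.4; KochNadirashviliSereginSverak2009, Thm 1.1 ff.; Teschl2012, §2.6; cell vocabulary (stmt-NavierStokesRegularity-20420)] -/
theorem nontrivialViscousEternalLaw_of_typeOne {R ε₀ ν : ℝ} (hε₀ : 0 < ε₀) (hν : 0 < ν)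
    {α : Fin 4 → Fin 4 → Fin 4 → ℤ × ℤ × ℤ → ℝ} (hα : InTableClass R α) {X₀ : Fin 4 → ℝ}
    {X : Fin 4 → ℤ → ℝ → ℝ} {tStar : ℝ} (hV : ViscousUpTo ε₀ ν α X₀ X tStar) (hB : BlowsUpAt ε₀ X tStar)
    (hT1 : TypeOne ε₀ X tStar) :
    ∃ νh : ℝ, 0 ≤ νh ∧ ∃ W : ℤ → ℝ → Em 4,
      (∀ (n : ℤ) (σ : ℝ), HasDerivAt (W n) (-((1 : ℝ) • W n σ) + tableQ α (W n σ)
        + bigLam ε₀ • tableA α (W (n - 1) σ) + (bigLam ε₀)⁻¹ • tableB α (W (n + 1) σ) (W n σ)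
        - (νh * ((1 + ε₀) ^ ((2 : ℝ) * n) * Real.exp (-σ))) • W n σ) σ) ∧
      UniformBound W ∧ 1 / (32 * (3 + bigLam ε₀)) ≤ ‖W 0 0‖ := by
  have hl0 : (0 : ℝ) < 1 + ε₀ := by linarith
  have hΛ : 0 < bigLam ε₀ := bigLam_pos (by linarith)
  have hT : 0 < tStar := hV.pos
  -- the upper clock at the critical front
  obtain ⟨K₁, t₁, hK₁, ht₁T, hclock⟩ := frontClock_of_typeOne hε₀ hν hα hV hT1
  -- type I in norm form
  obtain ⟨C₀, hC₀⟩ := hT1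
  set C : ℝ := 2 * max C₀ 0 with hCdef
  have htypeI : ∀ (n : ℤ) (t : ℝ), 0 ≤ t → t < tStar → bigLam ε₀ ^ n * (tStar - t) * ‖shellVec X n t‖ ≤ C := by
    intro n t ht0 htT
    have hLt : 0 < bigLam ε₀ ^ n * (tStar - t) := mul_pos (zpow_pos hΛ n) (by linarith)
    have hcomp : ∀ j : Fin 4, |X j n t| ≤ max C₀ 0 / (bigLam ε₀ ^ n * (tStar - t)) := by
      intro j
      rw [le_div_iff₀ hLt]
      calc |X j n t| * (bigLam ε₀ ^ n * (tStar - t)) = bigLam ε₀ ^ n * |X j n t| * (tStar - t) := by ring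
        _ ≤ C₀ := hC₀ t ht0 htT j n
        _ ≤ max C₀ 0 := le_max_left _ _
    have h := norm_shellVec_le_two_mul (div_nonneg (le_max_right _ _) hLt.le) hcomp
    have hne : bigLam ε₀ ^ n * (tStar - t) ≠ 0 := hLt.ne'
    calc bigLam ε₀ ^ n * (tStar - t) * ‖shellVec X n t‖
        ≤ bigLam ε₀ ^ n * (tStar - t) * (2 * (max C₀ 0 / (bigLam ε₀ ^ n * (tStar - t)))) :=
          mul_le_mul_of_nonneg_left h hLt.le
      _ = C := by rw [hCdef, mul_comm (2 : ℝ) _, ← mul_assoc, mul_div_cancel₀ _ hne, mul_comm]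
  -- the renormalisation
  set W : ℤ → ℝ → Em 4 := fun n σ => (bigLam ε₀ ^ n * Real.exp (-σ)) • shellVec X n (tStar - Real.exp (-σ)) with hWdef
  have hW : ∀ n σ, W n σ = (bigLam ε₀ ^ n * Real.exp (-σ)) • shellVec X n (tStar - Real.exp (-σ)) := fun n σ => rfl
  -- the centres: times `t_j = t⋆ - e^{-s_j} ↑ t⋆` past `max t₁ 0`, critical-front shells there
  set t₀ : ℝ := max t₁ 0 with ht₀
  have ht₀T : t₀ < tStar := max_lt ht₁T hT
  have hgap : 0 < tStar - t₀ := by linarith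
  set S₀ : ℝ := -Real.log (tStar - t₀) with hS₀
  set s : ℕ → ℝ := fun j => (j : ℝ) + S₀ with hs_def
  have hs : Tendsto s atTop atTop := tendsto_atTop_add_const_right _ _ tendsto_natCast_atTop_atTop
  have hexp_s : ∀ j : ℕ, Real.exp (-(s j)) = Real.exp (-(j : ℝ)) * (tStar - t₀) := by
    intro j
    show Real.exp (-((j : ℝ) + S₀)) = _
    rw [hS₀, neg_add, neg_neg, Real.exp_add, Real.exp_log hgap]
  set tj : ℕ → ℝ := fun j => tStar - Real.exp (-(s j)) with htj
  have htj_lt : ∀ j, tj j < tStar := fun j => by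
    show tStar - Real.exp (-(s j)) < tStar
    linarith [Real.exp_pos (-(s j))]
  have htj_ge : ∀ j, t₀ ≤ tj j := by
    intro j
    show t₀ ≤ tStar - Real.exp (-(s j))
    rw [hexp_s j]
    have h1 : Real.exp (-(j : ℝ)) ≤ 1 := Real.exp_le_one_iff.2 (by simp)
    nlinarith
  have htj0 : ∀ j, 0 ≤ tj j := fun j => (le_max_right _ _).trans (htj_ge j)
  have htj1 : ∀ j, t₁ ≤ tj j := fun j => (le_max_left _ _).trans (htj_ge j)
  have hTtj : ∀ j, tStar - tj j = Real.exp (-(s j)) := fun j => by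
    show tStar - (tStar - Real.exp (-(s j))) = _; ring
  choose i F hF using fun j : ℕ => typeOne_quantity_lower_bound hε₀ hν hα hV hB (tj j) (htj0 j) (htj_lt j)
  -- frame viscosities `r_j = ν(1+ε₀)^{2F_j}(t⋆ - t_j) ∈ [0, K₁]`
  have hr : ∀ j, ν * (1 + ε₀) ^ ((2 : ℝ) * F j) * Real.exp (-(s j)) ∈ Icc 0 K₁ := by
    intro j
    refine ⟨mul_nonneg (mul_nonneg hν.le (Real.rpow_nonneg hl0.le _)) (Real.exp_pos _).le, ?_⟩
    rw [← hTtj j]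
    exact (hclock (tj j) (htj0 j) (htj1 j) (htj_lt j) (i j) (F j) (hF j)).le
  obtain ⟨φ, hφ, νh, hνh, -, Wlim, hconv, hlaw, hbdd⟩ :=
    viscousEternalLawLimit_of_typeI hε₀ hν.le hT hV.contDiffOn hV.motion hW htypeI F s hs hr
  refine ⟨νh, hνh.1, Wlim, hlaw, ⟨C, hbdd⟩, ?_⟩
  -- non-triviality at the anchor
  have hanchor : ∀ j, 1 / (32 * (3 + bigLam ε₀)) ≤ ‖W (0 + F (φ j)) (0 + s (φ j))‖ := by
    intro j
    rw [zero_add, zero_add, renormalisedFlow_norm hε₀ hW (F (φ j)) (s (φ j))]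
    have ht : tStar - Real.exp (-(s (φ j))) = tj (φ j) := rfl
    rw [ht, ← hTtj (φ j)]
    have h1 := abs_apply_le_norm_shellVec X (F (φ j)) (tj (φ j)) (i (φ j))
    have h2 : 0 ≤ bigLam ε₀ ^ F (φ j) * (tStar - tj (φ j)) :=
      (mul_pos (zpow_pos hΛ _) (by linarith [htj_lt (φ j)])).le
    calc 1 / (32 * (3 + bigLam ε₀)) ≤ bigLam ε₀ ^ F (φ j) * |X (i (φ j)) (F (φ j)) (tj (φ j))| * (tStar - tj (φ j)) :=
          hF (φ j)
      _ = bigLam ε₀ ^ F (φ j) * (tStar - tj (φ j)) * |X (i (φ j)) (F (φ j)) (tj (φ j))| := by ring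
      _ ≤ bigLam ε₀ ^ F (φ j) * (tStar - tj (φ j)) * ‖shellVec X (F (φ j)) (tj (φ j))‖ :=
          mul_le_mul_of_nonneg_left h1 h2
  have hc := (hconv 0 (fun _ => (0 : ℝ)) 0 tendsto_const_nhds).norm
  exact ge_of_tendsto hc (Eventually.of_forall hanchor)

end Summit.NavierStokesRegularity.NavierStokesRegularity.Theorems.EternalRigidityViscBddOne.ViscousLawLimit

end
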